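import Mathlib
import HarnessLib
import Literature.MathematicalPhysics.QuantumLattice.ScaleZeroMultiplierJoint
import Literature.MathematicalPhysics.QuantumLattice.HubbardUVSymbolBandComposition
import Literature.MathematicalPhysics.QuantumLattice.FramePosKernelFirstMoment
import Literature.Analysis.Calculus.IteratedDifferenceBound

/-!
# The padded scale-`0` sector multiplier: TIME differences of EVERY order, `‖Δ_u^n G_ω(·, q⃗)‖ ≤ (2π/β)ⁿ · n!·B·(2/e₀)ⁿ`

Topic `MathematicalPhysics/QuantumLattice`; continues `HubbardScaleZeroSectorSymbolTime` (the padded symbol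
`G_ω(q₀, q⃗) = [val q₀ < 2M]·φ_{e_K(q⃗)}(ω̃_{q₀})·ζ_{0,ω}(θ(q⃗))` of BGM's scale-`0` anisotropic sector multiplier on `(ℤ/N) × (ℤ/L)²`, its sup,
support and SECOND time differences) and `ScaleZeroMultiplierJoint` (the cutoff factor `φ_e(ν) = H₀(√(ν²+e²))` as ONE smooth function
`bgmCutoff₂ e₀` on the frequency–band plane with `‖Dⁿ‖ ≤ n!·B·(2/e₀)ⁿ`).  For the first TIME MOMENT of the scale-`0` multiplier kernels with the
additive weight (`TorusFourierAdditiveTimeMoment`: monomial `X`, pure time differences of order `6`, pure space differences of order `2`;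
cell gate-hubbard-kl, K3 engine (E4)₀, the time part `T_T` of the multiplier weighted torus sum `T_w`) the padded symbol must be differenced
`n` times in the time direction, for every `q₀` including the padding seam:

* §1 (generic) `exists_ne_zero_of_fwdDiff_iter_ne_zero`, `card_support_fwdDiff_iter_le` (`#{Δ_wⁿG ≠ 0} ≤ (n+1)·#{G ≠ 0}`),
  `sum_norm_sq_fwdDiff_iter_le` (`Σ‖Δ_wⁿG‖² ≤ (n+1)·N_s·B²`);
* §2 `contDiff_cutoffFreqFn_freq`, **`norm_iteratedDeriv_cutoffFreqFn_freq_le`** — `‖∂_νⁿ φ_e(ν)‖ ≤ n!·B·(2/e₀)ⁿ` for all `e, ν` (the frequency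
  line `ν ↦ (ν, e)` is an isometric affine line of the plane; `ContinuousLinearMap.iteratedFDeriv_comp_right`);
* §3 `abs_gridFreq_ge_of_edge`, `bgmGridSymbol_eq_zero_of_edge_band` — the symbol VANISHES on the edge band `val q₀ ≤ k ∨ 2M ≤ val q₀ + k + 1`
  once `e₀β ≤ π(2M − 2k − 1)` (there `|ω̃| ≥ π(2M−2k−1)/β ≥ e₀`);
* §4 **`norm_fwdDiff_iter_time_bgmGridSymbol_le`** — for EVERY `q₀` (`2M ≤ N`, `e₀β ≤ π(2M−2n−1)`): in the interior `val q₀ + n < 2M` the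
  lattice difference IS the continuum `n`-th difference of `ν ↦ φ_e(ν)·ζ` at step `2π/β` (`fwdDiff_iter_eq_smul_of_sample`, then
  `norm_fwdDiff_iter_le_of_iteratedDeriv`); elsewhere all `n+1` samples vanish; `…_prod_le` (step `(u, 0)` on the product torus) and
  **`sum_norm_sq_fwdDiff_iter_time_bgmGridSymbol_le`** (the `ℓ²` input of the additive-weight Plancherel).

Everything is proved; no definitions, no named facts.

## Sources

G. Benfatto, A. Giuliani, V. Mastropietro, Ann. Henri Poincaré 7 (2006) 809–898, §2.5 (2.45)–(2.48), Lemma 2.2 (2.36aa), §2.8 (2.81)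
(`BenfattoGiulianiMastropietro2006`); M. Salmhofer, *Renormalization* (1999), §4.2.4 (4.63) (`Salmhofer1999`).
-/

noncomputable section

namespace Literature.MathematicalPhysics.QuantumLattice

open Literature.Probability.LatticeModels Literature.MathematicalPhysics.QuantumLattice.FermiRG Finset Complex Set Filter
open scoped Nat

/-! ### §1 Supports of iterated differences -/

/-- If `Δ_wⁿ g (x) ≠ 0` then one of the samples `g(x + j w)`, `j ≤ n`, is nonzero (`Δ_wⁿ g(x) = Σ_j (−1)^{n−j} C(n,j) g(x + jw)`).
[cite: BenfattoGiulianiMastropietro2006, Lemma 2.2 (2.36aa)] -/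
theorem exists_ne_zero_of_fwdDiff_iter_ne_zero {A E : Type*} [AddCommMonoid A] [AddCommGroup E] (w : A) (g : A → E) (x : A)
    {n : ℕ} (h : (fwdDiff w)^[n] g x ≠ 0) : ∃ j : ℕ, j ≤ n ∧ g (x + j • w) ≠ 0 := by
  by_contra hall
  push Not at hall
  apply h
  rw [fwdDiff_iter_eq_sum_shift]
  refine sum_eq_zero fun k hk => ?_
  rw [hall k (Nat.lt_succ_iff.1 (mem_range.1 hk)), smul_zero]

/-- The support of an `n`-th difference lies in `n+1` translates of the support: `#{Δ_wⁿ G ≠ 0} ≤ (n+1)·#{G ≠ 0}`.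
[cite: BenfattoGiulianiMastropietro2006, Lemma 2.2 (2.36aa)] -/
theorem card_support_fwdDiff_iter_le {α : Type*} [AddCommGroup α] [Fintype α] [DecidableEq α] (G : α → ℂ) (w : α) (n : ℕ) :
    (univ.filter fun x => (fwdDiff w)^[n] G x ≠ 0).card ≤ (n + 1) * (univ.filter fun x => G x ≠ 0).card := by
  classical
  set S := univ.filter (fun x => G x ≠ 0) with hS
  set T := (range (n + 1)).biUnion (fun j => S.image fun x => x - j • w) with hT
  have hsub : (univ.filter fun x => (fwdDiff w)^[n] G x ≠ 0) ⊆ T := by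
    intro x hx
    have h := (mem_filter.1 hx).2
    obtain ⟨j, hj, hne⟩ := exists_ne_zero_of_fwdDiff_iter_ne_zero w G x h
    rw [hT, Finset.mem_biUnion]
    exact ⟨j, mem_range.2 (Nat.lt_succ_of_le hj), mem_image.2 ⟨x + j • w, mem_filter.2 ⟨mem_univ _, hne⟩, by simp⟩⟩
  calc (univ.filter fun x => (fwdDiff w)^[n] G x ≠ 0).card ≤ T.card := card_le_card hsub
    _ ≤ ∑ j ∈ range (n + 1), (S.image fun x => x - j • w).card := card_biUnion_le
    _ ≤ ∑ _j ∈ range (n + 1), S.card := sum_le_sum fun j _ => card_image_le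
    _ = (n + 1) * S.card := by rw [sum_const, card_range, smul_eq_mul]

/-- `Σ_x ‖Δ_wⁿ G x‖² ≤ (n+1)·N_s·B²` when `‖Δ_wⁿ G‖ ≤ B` pointwise and `#{G ≠ 0} ≤ N_s` (the `ℓ²` size of a differenced symbol from its
sup and support, as in (2.81) with footnote ¹). [cite: BenfattoGiulianiMastropietro2006, §2.8 (2.81)] -/
theorem sum_norm_sq_fwdDiff_iter_le {α : Type*} [AddCommGroup α] [Fintype α] [DecidableEq α] (G : α → ℂ) (w : α) (n : ℕ) {Ns : ℕ}
    (hsupp : (univ.filter fun x => G x ≠ 0).card ≤ Ns) {B : ℝ} (hB : ∀ x, ‖(fwdDiff w)^[n] G x‖ ≤ B) :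
    ∑ x, ‖(fwdDiff w)^[n] G x‖ ^ 2 ≤ (n + 1) * Ns * B ^ 2 := by
  classical
  set F := (fwdDiff w)^[n] G with hF
  have hsplit : ∑ x, ‖F x‖ ^ 2 = ∑ x ∈ univ.filter (fun x => F x ≠ 0), ‖F x‖ ^ 2 := by
    rw [sum_filter]
    refine sum_congr rfl fun x _ => ?_
    split_ifs with h
    · rfl
    · rw [not_ne_iff] at h
      rw [h, norm_zero]
      norm_num
  rw [hsplit]
  have hc : ((univ.filter fun x => F x ≠ 0).card : ℝ) ≤ (n + 1) * Ns := by
    have h := (card_support_fwdDiff_iter_le G w n).trans (Nat.mul_le_mul_left (n + 1) hsupp)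
    exact_mod_cast h
  calc ∑ x ∈ univ.filter (fun x => F x ≠ 0), ‖F x‖ ^ 2 ≤ ∑ x ∈ univ.filter (fun x => F x ≠ 0), B ^ 2 :=
        sum_le_sum fun x _ => pow_le_pow_left₀ (norm_nonneg _) (hB x) 2
    _ = ((univ.filter fun x => F x ≠ 0).card : ℝ) * B ^ 2 := by rw [sum_const, nsmul_eq_mul]
    _ ≤ (n + 1) * Ns * B ^ 2 := mul_le_mul_of_nonneg_right hc (sq_nonneg _)

/-! ### §2 Frequency derivatives of the cutoff factor, every order -/

section Freq

variable {e₀ : ℝ}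

/-- The frequency line of the plane: `ν ↦ (ν, e) = ν•e₀ + e•e₁`, with the linear part `ν ↦ ν•e₀` of norm `≤ 1`.
[cite: BenfattoGiulianiMastropietro2006, §2.5 (2.48)] -/
theorem cutoffFreqFn_eq_bgmCutoff₂_comp (he : e₀ ≠ 0) (e : ℝ) :
    (fun ν : ℝ => cutoffFreqFn e₀ e ν) =
      (fun y : FreqBand => bgmCutoff₂ e₀ (y + e • fbE1)) ∘ fun ν : ℝ => (ContinuousLinearMap.toSpanSingleton ℝ fbE0) ν := by
  funext ν
  simp only [Function.comp_apply, ContinuousLinearMap.toSpanSingleton_apply]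
  rw [bgmCutoff₂_eq_cutoffFreqFn he]
  congr 1
  · simp [fbE0, fbE1]
  · simp [fbE0, fbE1]

/-- `ν ↦ φ_e(ν)` is smooth. [cite: BenfattoGiulianiMastropietro2006, §2.2 (2.9)] -/
theorem contDiff_cutoffFreqFn_freq (he : 0 < e₀) (e : ℝ) {n : ℕ∞} : ContDiff ℝ n (fun ν : ℝ => cutoffFreqFn e₀ e ν) := by
  rw [cutoffFreqFn_eq_bgmCutoff₂_comp he.ne' e]
  exact ((contDiff_bgmCutoff₂ he).comp (contDiff_id.add contDiff_const)).comp (ContinuousLinearMap.contDiff _)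

/-- **All frequency derivatives of the cutoff factor**: if `B ≥ 1` bounds the unit-profile derivatives `‖g^{(i)}‖`, `i ≤ N`
(`ScaleZeroMultiplierJoint.exists_norm_iteratedDeriv_bgmCutoffSqUnit_le`), then for `n ≤ N` and all `e, ν`:
`‖∂_νⁿ φ_e(ν)‖ ≤ n!·B·(2/e₀)ⁿ`. [cite: BenfattoGiulianiMastropietro2006, Lemma 2.2 (2.36aa)] -/
theorem norm_iteratedDeriv_cutoffFreqFn_freq_le (he : 0 < e₀) {N : ℕ} {B : ℝ} (hB1 : 1 ≤ B)
    (hB : ∀ i ≤ N, ∀ u, ‖iteratedDeriv i (bgmCutoffSqUnit e₀) u‖ ≤ B) {n : ℕ} (hn : n ≤ N) (e ν : ℝ) :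
    ‖iteratedDeriv n (fun ν : ℝ => cutoffFreqFn e₀ e ν) ν‖ ≤ n ! * B * (2 / e₀) ^ n := by
  set Lmap : ℝ →L[ℝ] FreqBand := ContinuousLinearMap.toSpanSingleton ℝ fbE0 with hL
  set g : FreqBand → ℝ := fun y => bgmCutoff₂ e₀ (y + e • fbE1) with hg
  have hgC : ContDiff ℝ n g := (contDiff_bgmCutoff₂ he).comp (contDiff_id.add contDiff_const)
  have hLnorm : ‖Lmap‖ ≤ 1 := by
    rw [hL, ContinuousLinearMap.norm_toSpanSingleton, norm_fbE0]
  rw [← norm_iteratedFDeriv_eq_norm_iteratedDeriv, cutoffFreqFn_eq_bgmCutoff₂_comp he.ne' e,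
    ContinuousLinearMap.iteratedFDeriv_comp_right Lmap hgC ν le_rfl]
  have hga : iteratedFDeriv ℝ n g (Lmap ν) = iteratedFDeriv ℝ n (bgmCutoff₂ e₀) (Lmap ν + e • fbE1) := by
    rw [hg, iteratedFDeriv_comp_add_right' n (e • fbE1)]
  calc ‖(iteratedFDeriv ℝ n g (Lmap ν)).compContinuousLinearMap fun _ => Lmap‖
      ≤ ‖iteratedFDeriv ℝ n g (Lmap ν)‖ * ∏ _i : Fin n, ‖Lmap‖ := ContinuousMultilinearMap.norm_compContinuousLinearMap_le _ _
    _ ≤ (n ! * B * (2 / e₀) ^ n) * 1 := by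
        refine mul_le_mul ?_ ?_ (by positivity) (by have := zero_le_one.trans hB1; positivity)
        · rw [hga]; exact norm_iteratedFDeriv_bgmCutoff₂_le he hB1 hB hn _
        · rw [prod_const, card_univ, Fintype.card_fin]
          exact pow_le_one₀ (norm_nonneg _) hLnorm
    _ = n ! * B * (2 / e₀) ^ n := mul_one _

end Freq

/-! ### §3 The edge band of the padded frequencies -/

section Edge

variable {L M N : ℕ}

/-- On the edge band `val q₀ ≤ k ∨ 2M ≤ val q₀ + k + 1` the padded frequency has `|ω̃| ≥ π(2M − 2k − 1)/β` (`0 < β`).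
[cite: Salmhofer1999, §4.2.4 (4.63)] -/
theorem abs_gridFreq_ge_of_edge {β : ℝ} (hβ : 0 < β) (q₀ : TorusSite 1 N) {k : ℕ}
    (h : (q₀ 0).val ≤ k ∨ 2 * M ≤ (q₀ 0).val + k + 1) :
    Real.pi * (2 * M - 2 * k - 1) / β ≤ |gridFreq M N β q₀| := by
  unfold gridFreq
  rw [abs_div, abs_of_pos hβ, abs_mul, abs_of_pos Real.pi_pos]
  refine div_le_div_of_nonneg_right (mul_le_mul_of_nonneg_left ?_ Real.pi_pos.le) hβ.le
  rcases h with h | h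
  · have hv : ((q₀ 0).val : ℝ) ≤ k := by exact_mod_cast h
    rw [le_abs]
    right
    linarith
  · have hv : (2 * M : ℝ) ≤ (q₀ 0).val + k + 1 := by exact_mod_cast h
    rw [le_abs]
    left
    linarith

variable [NeZero L]

omit [NeZero L] in
/-- **The padded multiplier vanishes on the edge band** `val q₀ ≤ k ∨ 2M ≤ val q₀ + k + 1` once `e₀β ≤ π(2M − 2k − 1)` (there
`|ω̃| ≥ e₀`; in the padding it is `0` anyway). [cite: Salmhofer1999, §4.2.4 (4.63)] -/
theorem bgmGridSymbol_eq_zero_of_edge_band {e₀ β : ℝ} (he : 0 < e₀) (hβ : 0 < β) {k : ℕ}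
    (hM : e₀ * β ≤ Real.pi * (2 * M - 2 * k - 1)) (μ : ℝ) (K : TrigPolyC4v) (ω : Fin (sectorCount 0)) {q₀ : TorusSite 1 N}
    (hq : (q₀ 0).val ≤ k ∨ 2 * M ≤ (q₀ 0).val + k + 1) (qv : TorusSite 2 L) :
    bgmGridSymbol L M N e₀ β μ K ω q₀ qv = 0 := by
  refine bgmGridSymbol_eq_zero_of_le_abs_gridFreq he β μ K ω (le_trans ?_ (abs_gridFreq_ge_of_edge hβ q₀ hq)) qv
  rw [le_div_iff₀ hβ]
  exact hM

end Edge

/-! ### §4 Time differences of every order -/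

section TimeDiff

variable {L M N : ℕ} [NeZero N]

/-- **The `n`-th time difference of the padded multiplier, every `q₀`**: for `0 < β`, `0 < e₀`, `2M ≤ N`, `e₀β ≤ π(2M − 2n − 1)`, and
`B ≥ 1` bounding the unit-profile derivatives of orders `≤ N'` with `n ≤ N'`,
`‖(Δ_u)ⁿ G_ω(·, q⃗)(q₀)‖ ≤ (2π/β)ⁿ · (n!·B·(2/e₀)ⁿ)` (`u = 1 ∈ ℤ/N`): in the interior `val q₀ + n < 2M` it is the continuum `n`-th difference of
`ν ↦ ψ_{e_K(q⃗)}(ν)·ζ` at step `2π/β`; otherwise all `n+1` samples lie on the edge band or in the padding and vanish.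
[cite: BenfattoGiulianiMastropietro2006, Lemma 2.2 (2.36aa)] -/
theorem norm_fwdDiff_iter_time_bgmGridSymbol_le {e₀ β : ℝ} (he : 0 < e₀) (hβ : 0 < β) {n : ℕ} (hMN : 2 * M ≤ N)
    (hM : e₀ * β ≤ Real.pi * (2 * M - 2 * n - 1)) {N' : ℕ} {B : ℝ} (hB1 : 1 ≤ B)
    (hB : ∀ i ≤ N', ∀ u, ‖iteratedDeriv i (bgmCutoffSqUnit e₀) u‖ ≤ B) (hn : n ≤ N') (μ : ℝ) (K : TrigPolyC4v)
    (ω : Fin (sectorCount 0)) (q₀ : TorusSite 1 N) (qv : TorusSite 2 L) :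
    ‖(fwdDiff (fun _ : Fin 1 => (1 : ZMod N)))^[n] (fun q => bgmGridSymbol L M N e₀ β μ K ω q qv) q₀‖ ≤
      (2 * Real.pi / β) ^ n * (n ! * B * (2 / e₀) ^ n) := by
  have hB0 : 0 ≤ B := zero_le_one.trans hB1
  have hRHS : 0 ≤ (2 * Real.pi / β) ^ n * (n ! * B * (2 / e₀) ^ n) := by positivity
  -- the edge condition forces `n < M` (`e₀β > 0`), so the `n + 1` samples never wrap twice
  have hnM : n < M := by
    by_contra hc
    push Not at hc
    have h1 : (2 * (M : ℝ) - 2 * n - 1) ≤ -1 := by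
      have : (M : ℝ) ≤ n := by exact_mod_cast hc
      linarith
    have h2 : 0 < e₀ * β := mul_pos he hβ
    nlinarith [Real.pi_pos]
  set u : TorusSite 1 N := fun _ : Fin 1 => (1 : ZMod N) with hu
  set e : ℝ := nambuXiCT L μ K qv with he'
  set ζ : ℝ := sectorWeightCirc 0 ω (momentumAngle L qv) with hζ
  have hζ1 : |ζ| ≤ 1 := by
    rw [abs_of_nonneg (sectorWeightCirc_nonneg 0 _ _)]
    exact sectorWeightCirc_le_one 0 _ _
  by_cases hint : (q₀ 0).val + n < 2 * M
  · -- interior: the lattice difference is the continuum difference of `ψ(ν) = ψ_e(ν)·ζ`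
    set h : ℝ := 2 * Real.pi / β with hh
    have hh0 : 0 ≤ h := by positivity
    set ν₀ : ℝ := gridFreq M N β q₀ with hν₀
    set ψ : ℝ → ℂ := fun ν => ((ζ : ℝ) : ℂ) * ((cutoffFreqFn e₀ e ν : ℝ) : ℂ) with hψ
    have hs : ∀ k ≤ n, (fun q => bgmGridSymbol L M N e₀ β μ K ω q qv) (q₀ + k • u) = (1 : ℝ) • ψ (ν₀ + k • h) := by
      intro k hk
      have hkN : (q₀ 0).val + k < N := by omega
      have hval : ((q₀ + k • u) 0).val = (q₀ 0).val + k := by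
        rw [val_add_smul_timeStep q₀ (by omega), Nat.mod_eq_of_lt hkN]
      have hlt : ((q₀ + k • u) 0).val < 2 * M := by rw [hval]; omega
      simp only [one_smul]
      rw [bgmGridSymbol_eq, if_pos hlt, gridFreq_add_smul β q₀ k hkN, hψ, ← he', ← hζ, nsmul_eq_mul]
      push_cast
      ring
    have hsample := Literature.Analysis.fwdDiff_iter_eq_smul_of_sample (R := ℝ) (K := (1 : ℝ)) (n := n) (G := fun q => bgmGridSymbol L M N e₀ β μ K ω q qv)
      (f := ψ) (y' := q₀) (y := ν₀) (h' := u) (h := h) hs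
    rw [hsample, one_smul]
    -- the continuum `n`-th difference
    have hf : ContDiff ℝ n (fun ν : ℝ => cutoffFreqFn e₀ e ν) := contDiff_cutoffFreqFn_freq he e
    have hfC : ContDiff ℝ n (fun ν : ℝ => ((cutoffFreqFn e₀ e ν : ℝ) : ℂ)) := Complex.ofRealCLM.contDiff.comp hf
    have hψC : ContDiff ℝ n ψ := contDiff_const.mul hfC
    have hderiv : ∀ t, ‖iteratedDeriv n ψ t‖ ≤ n ! * B * (2 / e₀) ^ n := by
      intro t
      rw [hψ, iteratedDeriv_const_mul _ hfC.contDiffAt, norm_mul, Complex.norm_real, Real.norm_eq_abs]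
      have hcast : ‖iteratedDeriv n (fun ν : ℝ => ((cutoffFreqFn e₀ e ν : ℝ) : ℂ)) t‖ =
          ‖iteratedDeriv n (fun ν : ℝ => cutoffFreqFn e₀ e ν) t‖ := by
        rw [← norm_iteratedFDeriv_eq_norm_iteratedDeriv, ← norm_iteratedFDeriv_eq_norm_iteratedDeriv]
        have hco : (fun ν : ℝ => ((cutoffFreqFn e₀ e ν : ℝ) : ℂ)) = Complex.ofRealLI ∘ fun ν : ℝ => cutoffFreqFn e₀ e ν := rfl
        rw [hco, Complex.ofRealLI.norm_iteratedFDeriv_comp_left (hf.contDiffAt) le_rfl]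
      rw [hcast]
      calc |ζ| * ‖iteratedDeriv n (fun ν : ℝ => cutoffFreqFn e₀ e ν) t‖ ≤ 1 * (n ! * B * (2 / e₀) ^ n) :=
            mul_le_mul hζ1 (norm_iteratedDeriv_cutoffFreqFn_freq_le he hB1 hB hn e t) (norm_nonneg _) zero_le_one
        _ = n ! * B * (2 / e₀) ^ n := one_mul _
    exact norm_fwdDiff_iter_le_of_iteratedDeriv hh0 n ψ _ hψC hderiv ν₀
  · -- edge or padding: all samples vanish
    have hzero : ∀ k ≤ n, bgmGridSymbol L M N e₀ β μ K ω (q₀ + k • u) qv = 0 := by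
      intro k hk
      have hq : (q₀ 0).val < N := (q₀ 0).val_lt
      have hkN : k < N := by omega
      have hvalmod : ((q₀ + k • u) 0).val = ((q₀ 0).val + k) % N := val_add_smul_timeStep q₀ hkN
      refine bgmGridSymbol_eq_zero_of_edge_band he hβ hM μ K ω ?_ qv
      by_cases hw : (q₀ 0).val + k < N
      · rw [hvalmod, Nat.mod_eq_of_lt hw]
        right; omega
      · have hw' : N ≤ (q₀ 0).val + k := Nat.le_of_not_lt hw
        have hlt : (q₀ 0).val + k - N < N := by omega
        rw [hvalmod, Nat.mod_eq_sub_mod hw', Nat.mod_eq_of_lt hlt]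
        left; omega
    have hvan : (fwdDiff u)^[n] (fun q => bgmGridSymbol L M N e₀ β μ K ω q qv) q₀ = 0 := by
      rw [fwdDiff_iter_eq_sum_shift]
      refine sum_eq_zero fun k hk => ?_
      have h0 := hzero k (Nat.lt_succ_iff.1 (mem_range.1 hk))
      simp only [h0, smul_zero]
    rw [hvan, norm_zero]
    exact hRHS

/-- The same difference written on the product torus with the step `(u, 0)` (the form of the additive-weight Plancherel).
[cite: BenfattoGiulianiMastropietro2006, Lemma 2.2 (2.36aa)] -/
theorem norm_fwdDiff_iter_time_bgmGridSymbol_prod_le {e₀ β : ℝ} (he : 0 < e₀) (hβ : 0 < β) {n : ℕ} (hMN : 2 * M ≤ N)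
    (hM : e₀ * β ≤ Real.pi * (2 * M - 2 * n - 1)) {N' : ℕ} {B : ℝ} (hB1 : 1 ≤ B)
    (hB : ∀ i ≤ N', ∀ u, ‖iteratedDeriv i (bgmCutoffSqUnit e₀) u‖ ≤ B) (hn : n ≤ N') (μ : ℝ) (K : TrigPolyC4v)
    (ω : Fin (sectorCount 0)) (q : TorusSite 1 N × TorusSite 2 L) :
    ‖(fwdDiff ((fun _ : Fin 1 => (1 : ZMod N)), (0 : TorusSite 2 L)))^[n]
        (fun q : TorusSite 1 N × TorusSite 2 L => bgmGridSymbol L M N e₀ β μ K ω q.1 q.2) q‖ ≤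
      (2 * Real.pi / β) ^ n * (n ! * B * (2 / e₀) ^ n) := by
  have h := norm_fwdDiff_iter_time_bgmGridSymbol_le he hβ hMN hM hB1 hB hn μ K ω q.1 q.2
  have hs : ∀ k ≤ n, (fun q : TorusSite 1 N × TorusSite 2 L => bgmGridSymbol L M N e₀ β μ K ω q.1 q.2)
      (q + k • ((fun _ : Fin 1 => (1 : ZMod N)), (0 : TorusSite 2 L))) =
      (1 : ℝ) • (fun q₀ => bgmGridSymbol L M N e₀ β μ K ω q₀ q.2) (q.1 + k • (fun _ : Fin 1 => (1 : ZMod N))) := by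
    intro k _
    simp [Prod.smul_mk]
  have hsample := Literature.Analysis.fwdDiff_iter_eq_smul_of_sample (R := ℝ) (K := (1 : ℝ)) (n := n)
    (G := fun q : TorusSite 1 N × TorusSite 2 L => bgmGridSymbol L M N e₀ β μ K ω q.1 q.2)
    (f := fun q₀ => bgmGridSymbol L M N e₀ β μ K ω q₀ q.2) (y' := q) (y := q.1)
    (h' := ((fun _ : Fin 1 => (1 : ZMod N)), (0 : TorusSite 2 L))) (h := fun _ : Fin 1 => (1 : ZMod N)) hs
  rw [hsample, one_smul]
  exact h

/-- **The `ℓ²` norm of the `n`-th time difference** (input of `TorusFourierAdditiveTimeMoment`): with a support count `#{G_ω ≠ 0} ≤ N_s`,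
`Σ_q ‖(Δ_{(u,0)})ⁿ G_ω(q)‖² ≤ (n+1)·N_s·((2π/β)ⁿ·n!·B·(2/e₀)ⁿ)²`. [cite: BenfattoGiulianiMastropietro2006, §2.8 (2.81)] -/
theorem sum_norm_sq_fwdDiff_iter_time_bgmGridSymbol_le [NeZero L] {e₀ β : ℝ} (he : 0 < e₀) (hβ : 0 < β) {n : ℕ} (hMN : 2 * M ≤ N)
    (hM : e₀ * β ≤ Real.pi * (2 * M - 2 * n - 1)) {N' : ℕ} {B : ℝ} (hB1 : 1 ≤ B)
    (hB : ∀ i ≤ N', ∀ u, ‖iteratedDeriv i (bgmCutoffSqUnit e₀) u‖ ≤ B) (hn : n ≤ N') (μ : ℝ) (K : TrigPolyC4v)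
    (ω : Fin (sectorCount 0)) {Ns : ℕ}
    (hsupp : (univ.filter fun q : TorusSite 1 N × TorusSite 2 L => bgmGridSymbol L M N e₀ β μ K ω q.1 q.2 ≠ 0).card ≤ Ns) :
    ∑ q : TorusSite 1 N × TorusSite 2 L,
        ‖(fwdDiff ((fun _ : Fin 1 => (1 : ZMod N)), (0 : TorusSite 2 L)))^[n]
          (fun q : TorusSite 1 N × TorusSite 2 L => bgmGridSymbol L M N e₀ β μ K ω q.1 q.2) q‖ ^ 2 ≤
      (n + 1) * Ns * ((2 * Real.pi / β) ^ n * (n ! * B * (2 / e₀) ^ n)) ^ 2 := by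
  classical
  exact sum_norm_sq_fwdDiff_iter_le _ _ n hsupp (norm_fwdDiff_iter_time_bgmGridSymbol_prod_le he hβ hMN hM hB1 hB hn μ K ω)

end TimeDiff

end Literature.MathematicalPhysics.QuantumLattice

end
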